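import Literature.NumberTheory.EllipticCurves.ComplexMultiplication
import Literature.NumberTheory.EllipticCurves.HasseWeilAbelian
import Literature.NumberTheory.EllipticCurves.LocalEulerFactorModel
import Literature.NumberTheory.EllipticCurves.TateModuleContinuityProofs
import Literature.NumberTheory.EllipticCurves.TateModuleFinite
import Literature.NumberTheory.EllipticCurves.NeronOggShafarevich
import HarnessLib

/-!
# Knapp's Theorem 11.67 (isogenous curves have the same `L`-function) from the Euler factors of
the Tate module

Sibling proof file of `Literature.NumberTheory.EllipticCurves.ComplexMultiplication` (D-0014
append protocol; everything here is proved, the only `def`s are the two pieces of data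
`ContinuousRep.inertiaCoinvariantsCongr` and `WeierstrassCurve.Isogeny.rationalTateModuleMap` /
`rationalTateModuleEquiv`).  It concerns the named fact `Literature.NumberTheory.EllipticCurves.LFunction_eq_of_isIsogenous`:

> Knapp, *Elliptic Curves*, Thm. 11.67 (PDF p. 281): *"Let `E` and `E'` be elliptic curves over
> `ℚ` that are isogenous over `ℚ`. Then `L(s,E) = L(s,E')`."*

stated in the tree for Mathlib's formal Euler product `WeierstrassCurve.LFunction`.  Knapp's
printed "sketch of proof" (pp. 281–282) treats only the primes `p ∤ ΔΔ'` ("We treat the `p`-th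
factor only for primes `p` not dividing `Δ` or `Δ'`, omitting the others"), takes for granted
that the isogeny reduces to an isogeny `F_p : E_p → E'_p` over `𝔽_p` and that `1 - φ` is
separable ((11.87), "a fundamental fact, which we shall not prove"), and concludes
`#E_p(𝔽_p) = deg(1 - φ₁) = #E'_p(𝔽_p)` from `F_p ∘ φ₁ = φ₂ ∘ F_p` (11.89).  A complete proof
— the one of Faltings, Invent. Math. 73 (1983), §5, Korollar 2 (ii) ⇒ (iv), or Silverman *AEC*
C.§16 with VII.7 — runs through the `ℓ`-adic Tate module and covers every prime at once:

1. an isogeny `φ : E → E'` over `K` induces a `Γ_K`-equivariant **isomorphism**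
   `V_ℓ φ : V_ℓ E ⥲ V_ℓ E'` of the rational Tate modules (`T_ℓ φ` is injective with both sides
   free of rank `2`; Silverman *AEC* III.7.1(a), III.7.4);
2. for every finite place `v ∤ ℓ` the local factor `L_v(E, T)` (`1 - a_vT + q_vT²`, `1 ∓ T`, `1`)
   is `det(1 - σ_v T ∣ (V_ℓ E)_{I_v})` (Serre–Tate, Ann. of Math. 88 (1968), Thm. 3 with §1
   (Néron–Ogg–Shafarevich); Silverman *AEC* C.§16; in the tree the **named fact**
   `WeierstrassCurve.hasseWeilEulerFactor_geomPoints W ℓ` of `HasseWeilAbelian`);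
3. hence `L_v(E, T) = L_v(E', T)` for every `v` (choose `ℓ ∈ {2, 3}` with `v ∤ ℓ`), and the Euler
   products agree factor by factor (`WeierstrassCurve.LFunction_eq_of_forall_localPolynomial_eq`,
   the prime-by-prime form of Thm. 11.67 already in the tree).

Steps 1 and 3 are **proved** here, unconditionally; step 2 is consumed as the hypothesis
`W.hasseWeilEulerFactor_geomPoints ℓ` (for elliptic `W` only — the schema has no `[W.IsElliptic]`
binder, see the end of `HasseWeilAbelian`).  The continuity and finiteness arguments of that fact
are supplied by the tree's theorems `WeierstrassCurve.continuous_rationalGaloisRepTate_holds`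
(`TateModuleContinuityProofs`) and `WeierstrassCurve.module_finite_rationalTateModule_holds`
(`TateModuleFinite`), and `dim V_ℓ E = 2` by `finrank_rationalTateModule_eq_two_holds`
(`TateModuleFinrankProofs`, Silverman III.7.1(a), proved there from `#E[n] = n²`).

## Contents (all proved)

* `Literature.NumberTheory.GaloisRepresentations.ContinuousRep.inertiaCoinvariantsCongr`, `…_conj_toInertiaCoinvariants`: an equivariant
  linear equivalence of continuous representations induces one on inertia coinvariants,
  conjugating the Frobenius actions; hence
* `Literature.NumberTheory.EllipticCurves.hasseWeilEulerFactor_eq_of_equiv`: **the Hasse–Weil Euler factors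
  `det(1 - σ T ∣ (V_ℓ M)_{I_𝔓})` of two discrete `Γ_K`-modules with `Γ_K`-isomorphic rational Tate
  modules coincide at every finite place** (`LinearEquiv.charpoly_conj`);
* `WeierstrassCurve.Isogeny.rationalTateModuleMap` (`V_ℓ φ = ℚ_ℓ ⊗ T_ℓ φ`), its injectivity and
  `Γ_K`-equivariance, and `WeierstrassCurve.Isogeny.rationalTateModuleEquiv`: for elliptic
  `E, E'` and `ℓ ≠ char K`, `V_ℓ φ` is a `Γ_K`-equivariant isomorphism (step 1);
* `WeierstrassCurve.Isogeny.hasseWeilEulerFactor_eq`: isogenous elliptic curves over a number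
  field have the same `ℓ`-adic Euler factors at every finite place;
* `WeierstrassCurve.Isogeny.localPolynomialAt_eq`,
  `WeierstrassCurve.IsIsogenous.LFunction_eq_of_hasseWeilEulerFactor_geomPoints`: over any number
  field, `K`-isogenous elliptic curves satisfying the Euler-factor fact have the same local
  polynomials at all finite places and the same `LFunction` (steps 2–3);
* `Literature.NumberTheory.EllipticCurves.LFunction_eq_of_isIsogenous_of_hasseWeilEulerFactor_geomPoints`: **the named fact
  `LFunction_eq_of_isIsogenous` (Knapp 11.67) follows from the schema
  `∀ W [W.IsElliptic] ℓ, W.hasseWeilEulerFactor_geomPoints ℓ` over `ℚ`.**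

What is *not* proved here is step 2 (the named fact `hasseWeilEulerFactor_geomPoints`: at good
places Silverman VII.4.1 + V.2.3.1, being reduced in `HasseWeilGoodReduction*`; at multiplicative
places the Tate curve; at additive places `(V_ℓ E)_{I_v} = 0`), so the discharge
`LFunction_eq_of_isIsogenous_holds` is not asserted: it is
`LFunction_eq_of_isIsogenous_of_hasseWeilEulerFactor_geomPoints h` for a proof `h` of that schema.

## References

* A. W. Knapp, *Elliptic Curves*, Math. Notes 40, Princeton (1992): Thm. 11.67 and its sketch of
  proof, (10.9)–(10.10) (PDF pp. 222, 281–282). [cite: Knapp1993]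
* J.-P. Serre, J. Tate, *Good reduction of abelian varieties*, Ann. of Math. 88 (1968), §1 and
  Thm. 3. [cite: SerreTate1968]
* G. Faltings, *Endlichkeitssätze für abelsche Varietäten über Zahlkörpern*, Invent. Math. 73
  (1983), §5, Korollar 2 ((ii) ⇒ (iv)). [cite: Faltings1983Endlichkeit]
* J. H. Silverman, *The Arithmetic of Elliptic Curves*, 2nd ed. (2009): III.7.1, III.7.4,
  VII.7.1–7.2, C.§16. [cite: SilvermanAEC2009]

## Design

Pure theorems plus three auxiliary definitions (data: the induced maps), no instances, no
`sorry`; `noncomputable section`, `open scoped Classical` as in the parent files; generic material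
in `namespace Literature` / `Literature.NumberTheory.GaloisRepresentations.ContinuousRep`, curve-specific material as deliberate dot-notation
extensions in `namespace WeierstrassCurve` (`Isogeny.*`, `IsIsogenous.*`), the reduction of the
named fact in `namespace Literature.BSD` next to it.
-/

noncomputable section

open scoped Classical NumberField TensorProduct

open Field IsDedekindDomain

universe u

namespace Literature.NumberTheory.EllipticCurves

/-! ## Equivariant equivalences and inertia coinvariants -/

section ContinuousRep
open Literature.NumberTheory.GaloisRepresentations (ContinuousRep)
open Literature.NumberTheory.GaloisRepresentations.ContinuousRep

variable {G : Type*} [Group G] [TopologicalSpace G] {A : Type*} [CommRing A] [TopologicalSpace A]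
  {M : Type*} [AddCommGroup M] [Module A M] [TopologicalSpace M]
  {M' : Type*} [AddCommGroup M'] [Module A M'] [TopologicalSpace M']
  {S : Type*} [CommRing S] [MulSemiringAction G S]
  (ρ : ContinuousRep G A M) (ρ' : ContinuousRep G A M') (e : M ≃ₗ[A] M')
  (he : ∀ (g : G) (x : M), e (ρ g x) = ρ' g (e x))

include he in
/-- The inverse of an equivariant linear equivalence is equivariant. [folklore] -/
theorem _root_.Literature.NumberTheory.GaloisRepresentations.ContinuousRep.symm_apply_equivariant (g : G) (y : M') : e.symm (ρ' g y) = ρ g (e.symm y) := by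
  apply e.injective
  rw [he, e.apply_symm_apply, e.apply_symm_apply]

/-- A `G`-equivariant `A`-linear equivalence `e : M ≃ M'` between two continuous representations
induces an `A`-linear equivalence `M_{I_𝔓} ≃ M'_{I_𝔓}` of their inertia coinvariants at any
prime `𝔓` (Mathlib `Representation.Coinvariants.map` in both directions).
Ref: Serre, *Facteurs locaux des fonctions zêta* (1970), §2.3 (functoriality of `V ↦ V_I`).
[folklore] -/
def _root_.Literature.NumberTheory.GaloisRepresentations.ContinuousRep.inertiaCoinvariantsCongr (𝔓 : Ideal S) :
    ρ.InertiaCoinvariants 𝔓 ≃ₗ[A] ρ'.InertiaCoinvariants 𝔓 :=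
  LinearEquiv.ofLinear
    (Representation.Coinvariants.map _ _
      ⟨e.toLinearMap, fun τ => LinearMap.ext fun x => he _ x⟩)
    (Representation.Coinvariants.map _ _
      ⟨e.symm.toLinearMap, fun τ => LinearMap.ext fun y =>
        symm_apply_equivariant ρ ρ' e he _ y⟩)
    (Representation.Coinvariants.hom_ext (LinearMap.ext fun y => by simp))
    (Representation.Coinvariants.hom_ext (LinearMap.ext fun x => by simp))

/-- `inertiaCoinvariantsCongr` on classes: `[x] ↦ [e x]`. [folklore] -/
@[simp]
theorem _root_.Literature.NumberTheory.GaloisRepresentations.ContinuousRep.inertiaCoinvariantsCongr_mk (𝔓 : Ideal S) (x : M) :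
    inertiaCoinvariantsCongr ρ ρ' e he 𝔓 (Representation.Coinvariants.mk _ x) =
      Representation.Coinvariants.mk _ (e x) :=
  rfl

/-- The inverse of `inertiaCoinvariantsCongr` on classes: `[y] ↦ [e⁻¹ y]`. [folklore] -/
@[simp]
theorem _root_.Literature.NumberTheory.GaloisRepresentations.ContinuousRep.inertiaCoinvariantsCongr_symm_mk (𝔓 : Ideal S) (y : M') :
    (inertiaCoinvariantsCongr ρ ρ' e he 𝔓).symm (Representation.Coinvariants.mk _ y) =
      Representation.Coinvariants.mk _ (e.symm y) :=
  rfl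

/-- The induced equivalence of inertia coinvariants conjugates the action of any `σ ∈ D_𝔓` on
`M_{I_𝔓}` into its action on `M'_{I_𝔓}`. Ref: Serre, *Facteurs locaux des fonctions zêta*
(1970), §2.3. [folklore] -/
theorem _root_.Literature.NumberTheory.GaloisRepresentations.ContinuousRep.inertiaCoinvariantsCongr_conj_toInertiaCoinvariants (𝔓 : Ideal S)
    (σ : 𝔓.decompositionSubgroup G) :
    (inertiaCoinvariantsCongr ρ ρ' e he 𝔓).conj (ρ.toInertiaCoinvariants 𝔓 σ) =
      ρ'.toInertiaCoinvariants 𝔓 σ := by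
  refine Representation.Coinvariants.hom_ext (LinearMap.ext fun y => ?_)
  simp only [LinearMap.coe_comp, Function.comp_apply, LinearEquiv.conj_apply_apply,
    inertiaCoinvariantsCongr_symm_mk, toInertiaCoinvariants_mk, inertiaCoinvariantsCongr_mk]
  change Representation.Coinvariants.mk _ (e (ρ σ (e.symm y))) =
    Representation.Coinvariants.mk _ (ρ' σ y)
  rw [he, e.apply_symm_apply]

end ContinuousRep

/-! ## Hasse–Weil Euler factors of `Γ_K`-isomorphic rational Tate modules -/

section EulerFactor

variable {K : Type u} [Field K]
  {M : Type u} [AddCommGroup M] [DistribMulAction (absoluteGaloisGroup K) M]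
  {M' : Type u} [AddCommGroup M'] [DistribMulAction (absoluteGaloisGroup K) M']
  (ℓ : ℕ) [Fact ℓ.Prime]

/-- **Euler factors only depend on the `Γ_K`-isomorphism class of `V_ℓ`.**  If the rational Tate
modules `V_ℓ M`, `V_ℓ M'` of two discrete `Γ_K`-modules are isomorphic as `ℚ_ℓ[Γ_K]`-modules
(`e` linear, `he` equivariant), then their Hasse–Weil Euler factors
`det(1 - σ T ∣ (V_ℓ)_{I_𝔓})` (`Literature.NumberTheory.EllipticCurves.hasseWeilEulerFactor`, same chosen `𝔓 ∣ v` and arithmetic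
Frobenius `σ` on both sides) agree at every finite place `v`: the induced equivalence of inertia
coinvariants conjugates the two Frobenius actions, and conjugate endomorphisms have the same
characteristic polynomial (`LinearEquiv.charpoly_conj`).  This is the step "(ii) ⇒ (iv)" of
Faltings, Invent. Math. 73 (1983), §5, Korollar 2.
[cite: Faltings1983Endlichkeit, §5 Korollar 2, (ii) ⇒ (iv)] -/
theorem hasseWeilEulerFactor_eq_of_equiv
    (h : Continuous fun x : absoluteGaloisGroup K × RationalTateModule M ℓ ↦
      rationalTateRepresentation (absoluteGaloisGroup K) M ℓ x.1 x.2)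
    (h' : Continuous fun x : absoluteGaloisGroup K × RationalTateModule M' ℓ ↦
      rationalTateRepresentation (absoluteGaloisGroup K) M' ℓ x.1 x.2)
    [Module.Finite ℚ_[ℓ] (RationalTateModule M ℓ)] [Module.Finite ℚ_[ℓ] (RationalTateModule M' ℓ)]
    (e : RationalTateModule M ℓ ≃ₗ[ℚ_[ℓ]] RationalTateModule M' ℓ)
    (he : ∀ (σ : absoluteGaloisGroup K) (x : RationalTateModule M ℓ),
      e (rationalTateRepresentation (absoluteGaloisGroup K) M ℓ σ x) =
        rationalTateRepresentation (absoluteGaloisGroup K) M' ℓ σ (e x))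
    (v : HeightOneSpectrum (𝓞 K)) :
    hasseWeilEulerFactor M ℓ h v = hasseWeilEulerFactor M' ℓ h' v := by
  unfold hasseWeilEulerFactor
  split_ifs with hex
  · congr 1
    rw [← GaloisRepresentations.ContinuousRep.inertiaCoinvariantsCongr_conj_toInertiaCoinvariants
      (rationalTateGaloisRepOf M ℓ h) (rationalTateGaloisRepOf M' ℓ h') e he,
      LinearEquiv.charpoly_conj]
  · rfl

end EulerFactor

end Literature.NumberTheory.EllipticCurves

/-! ## `V_ℓ` of an isogeny -/

namespace WeierstrassCurve

open Literature.NumberTheory.EllipticCurves Literature.NumberTheory.GaloisRepresentations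

namespace Isogeny

section AnyField

variable {K : Type u} [Field K] {W W' : WeierstrassCurve K} (ℓ : ℕ) [Fact ℓ.Prime]

/-- The map `V_ℓ φ = ℚ_ℓ ⊗ T_ℓ φ : V_ℓ E →ₗ[ℚ_ℓ] V_ℓ E'` of rational Tate modules induced by an
isogeny `φ : E → E'` (base change to `ℚ_[ℓ]` of the tree's `Literature.TateModule.map ℓ φ`).
Silverman, *AEC*, III.7.4 and Remark III.7.2. [folklore] -/
def rationalTateModuleMap (φ : Isogeny W W') :
    W.rationalTateModule ℓ →ₗ[ℚ_[ℓ]] W'.rationalTateModule ℓ :=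
  ((TateModule.map ℓ φ.toAddMonoidHom).baseChange ℚ_[ℓ] :
    W.rationalTateModule ℓ →ₗ[ℚ_[ℓ]] W'.rationalTateModule ℓ)

/-- `V_ℓ φ` on pure tensors: `c ⊗ x ↦ c ⊗ T_ℓ φ x`. [folklore] -/
@[simp]
theorem rationalTateModuleMap_tmul (φ : Isogeny W W') (c : ℚ_[ℓ]) (x : W.tateModule ℓ) :
    φ.rationalTateModuleMap ℓ
        ((c ⊗ₜ[ℤ_[ℓ]] x : ℚ_[ℓ] ⊗[ℤ_[ℓ]] W.tateModule ℓ) : W.rationalTateModule ℓ) =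
      ((c ⊗ₜ[ℤ_[ℓ]] TateModule.map ℓ φ.toAddMonoidHom x : ℚ_[ℓ] ⊗[ℤ_[ℓ]] W'.tateModule ℓ) :
        W'.rationalTateModule ℓ) :=
  rfl

/-- **`V_ℓ φ` is injective** for every isogeny `φ` (any field, any `ℓ`): `T_ℓ φ` is injective
(`Literature.AlgebraicGeometry.Motives.tateModule_map_injective`, finite kernel) and `ℚ_ℓ` is flat over `ℤ_ℓ`.
Silverman, *AEC*, III.7.4. [folklore] -/
theorem rationalTateModuleMap_injective (φ : Isogeny W W') :
    Function.Injective (φ.rationalTateModuleMap ℓ) := by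
  haveI : Module.Flat ℤ_[ℓ] ℚ_[ℓ] := IsLocalization.flat ℚ_[ℓ] (nonZeroDivisors ℤ_[ℓ])
  change Function.Injective ((TateModule.map ℓ φ.toAddMonoidHom).baseChange ℚ_[ℓ])
  rw [LinearMap.baseChange_eq_ltensor]
  exact Module.Flat.lTensor_preserves_injective_linearMap _ (Literature.AlgebraicGeometry.Motives.tateModule_map_injective ℓ φ)

/-- **`V_ℓ φ` is `Γ_K`-equivariant**: `V_ℓ φ (σ • x) = σ • V_ℓ φ x` for the rational Galois
representations `rationalGaloisRepTate` (base change of `Literature.AlgebraicGeometry.Motives.tateModule_map_smul`).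
Silverman, *AEC*, III.7.4 and III.§7. [folklore] -/
theorem rationalTateModuleMap_smul (φ : Isogeny W W') (σ : absoluteGaloisGroup K)
    (x : W.rationalTateModule ℓ) :
    φ.rationalTateModuleMap ℓ (rationalGaloisRepTate W ℓ σ x) =
      rationalGaloisRepTate W' ℓ σ (φ.rationalTateModuleMap ℓ x) := by
  have hT : (TateModule.map ℓ φ.toAddMonoidHom).comp (galoisRepTate W ℓ σ) =
      (galoisRepTate W' ℓ σ).comp (TateModule.map ℓ φ.toAddMonoidHom) :=
    LinearMap.ext fun y => Literature.AlgebraicGeometry.Motives.tateModule_map_smul ℓ φ σ y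
  have key : ((TateModule.map ℓ φ.toAddMonoidHom).baseChange ℚ_[ℓ]).comp
        ((galoisRepTate W ℓ σ).baseChange ℚ_[ℓ]) =
      ((galoisRepTate W' ℓ σ).baseChange ℚ_[ℓ]).comp
        ((TateModule.map ℓ φ.toAddMonoidHom).baseChange ℚ_[ℓ]) := by
    rw [← LinearMap.baseChange_comp, ← LinearMap.baseChange_comp, hT]
  exact LinearMap.congr_fun key x

variable [W.IsElliptic] [W'.IsElliptic]

/-- **An isogeny induces an isomorphism `V_ℓ E ⥲ V_ℓ E'`** for elliptic `E, E'` and a prime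
`ℓ ≠ char K`: `V_ℓ φ` is an injective `ℚ_ℓ`-linear map between spaces of the same dimension `2`
(`finrank_rationalTateModule_eq_two_holds`, Silverman III.7.1(a)), hence bijective
(Mathlib `LinearMap.linearEquivOfInjective`).  Silverman, *AEC*, III.7.1(a), III.7.4;
Faltings (1983), §5, Korollar 2, (i) ⇒ (ii). [cite: SilvermanAEC2009, Prop. III.7.1(a), III.7.4] -/
def rationalTateModuleEquiv (φ : Isogeny W W') (hℓ : (ℓ : K) ≠ 0) :
    W.rationalTateModule ℓ ≃ₗ[ℚ_[ℓ]] W'.rationalTateModule ℓ :=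
  haveI : Module.Finite ℚ_[ℓ] (W.rationalTateModule ℓ) := finite_rationalTateModule_of_ne_char W ℓ hℓ
  haveI : Module.Finite ℚ_[ℓ] (W'.rationalTateModule ℓ) :=
    finite_rationalTateModule_of_ne_char W' ℓ hℓ
  LinearMap.linearEquivOfInjective (φ.rationalTateModuleMap ℓ) (φ.rationalTateModuleMap_injective ℓ)
    (by rw [finrank_rationalTateModule_eq_two_holds W ℓ hℓ,
      finrank_rationalTateModule_eq_two_holds W' ℓ hℓ])

/-- The underlying map of `rationalTateModuleEquiv` is `V_ℓ φ`. [folklore] -/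
@[simp]
theorem rationalTateModuleEquiv_apply (φ : Isogeny W W') (hℓ : (ℓ : K) ≠ 0)
    (x : W.rationalTateModule ℓ) :
    φ.rationalTateModuleEquiv ℓ hℓ x = φ.rationalTateModuleMap ℓ x :=
  rfl

/-- `rationalTateModuleEquiv` is `Γ_K`-equivariant. Silverman, *AEC*, III.7.4. [folklore] -/
theorem rationalTateModuleEquiv_smul (φ : Isogeny W W') (hℓ : (ℓ : K) ≠ 0)
    (σ : absoluteGaloisGroup K) (x : W.rationalTateModule ℓ) :
    φ.rationalTateModuleEquiv ℓ hℓ (rationalGaloisRepTate W ℓ σ x) =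
      rationalGaloisRepTate W' ℓ σ (φ.rationalTateModuleEquiv ℓ hℓ x) := by
  rw [rationalTateModuleEquiv_apply, rationalTateModuleEquiv_apply, rationalTateModuleMap_smul]

end AnyField

/-! ## Isogenous elliptic curves over a number field: equal Euler factors, equal `L`-functions -/

section NumberField

variable {K : Type u} [Field K] [NumberField K] {W W' : WeierstrassCurve K}
  [W.IsElliptic] [W'.IsElliptic]

/-- **Isogenous elliptic curves have the same `ℓ`-adic Euler factors** at every finite place `v`
of the number field `K` (and every prime `ℓ`): `det(1 - σ T ∣ (V_ℓ E)_{I_v}) =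
det(1 - σ T ∣ (V_ℓ E')_{I_v})`, since `V_ℓ φ : V_ℓ E ⥲ V_ℓ E'` is a `Γ_K`-isomorphism
(`rationalTateModuleEquiv`, `Literature.NumberTheory.EllipticCurves.hasseWeilEulerFactor_eq_of_equiv`).  Faltings (1983), §5,
Korollar 2, (i) ⇒ (ii) ⇒ (iv); Silverman, *AEC*, C.§16.
[cite: Faltings1983Endlichkeit, §5 Korollar 2] -/
theorem hasseWeilEulerFactor_eq (φ : Isogeny W W') (ℓ : ℕ) [Fact ℓ.Prime]
    (h : Continuous fun x : absoluteGaloisGroup K × W.rationalTateModule ℓ ↦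
      rationalTateRepresentation (absoluteGaloisGroup K) (geomPoints W) ℓ x.1 x.2)
    (h' : Continuous fun x : absoluteGaloisGroup K × W'.rationalTateModule ℓ ↦
      rationalTateRepresentation (absoluteGaloisGroup K) (geomPoints W') ℓ x.1 x.2)
    [Module.Finite ℚ_[ℓ] (W.rationalTateModule ℓ)] [Module.Finite ℚ_[ℓ] (W'.rationalTateModule ℓ)]
    (v : HeightOneSpectrum (𝓞 K)) :
    hasseWeilEulerFactor (geomPoints W) ℓ h v = hasseWeilEulerFactor (geomPoints W') ℓ h' v :=
  have hℓ : (ℓ : K) ≠ 0 := Nat.cast_ne_zero.2 (Fact.out : ℓ.Prime).ne_zero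
  hasseWeilEulerFactor_eq_of_equiv ℓ h h' (φ.rationalTateModuleEquiv ℓ hℓ)
    (φ.rationalTateModuleEquiv_smul ℓ hℓ) v

/-- **Isogenous elliptic curves have the same local polynomial at every finite place**, granted
the Euler-factor description of the local polynomials of the two curves
(`hasseWeilEulerFactor_geomPoints`, Serre–Tate (1968) Thm. 3 / Silverman *AEC* C.§16, hypotheses
`hW`, `hW'`): choose a prime `ℓ` with `v ∤ ℓ` (the tree's
`IsDedekindDomain.HeightOneSpectrum.exists_prime_natCast_not_mem`, file `NeronOggShafarevich`); then `L_v(E, T)` and `L_v(E', T)`, mapped into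
`ℚ_ℓ[T]`, are the `ℓ`-adic Euler factors of `V_ℓ E ≅ V_ℓ E'` (`hasseWeilEulerFactor_eq`), and
`ℤ[T] → ℚ_ℓ[T]` is injective.  The continuity and finiteness inputs of the fact are the tree's
`continuous_rationalGaloisRepTate_holds` and `module_finite_rationalTateModule_holds`.
This is the prime-by-prime content of Knapp, *Elliptic Curves*, Thm. 11.67 ("the two `L`
functions will be equal factor by factor"), at *all* primes.
[cite: Knapp1993, Thm. 11.67 (PDF p. 281)] [cite: SerreTate1968, Thm. 3] -/
theorem localPolynomialAt_eq (φ : Isogeny W W')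
    (hW : ∀ (ℓ : ℕ) [Fact ℓ.Prime], W.hasseWeilEulerFactor_geomPoints ℓ)
    (hW' : ∀ (ℓ : ℕ) [Fact ℓ.Prime], W'.hasseWeilEulerFactor_geomPoints ℓ)
    (v : HeightOneSpectrum (𝓞 K)) :
    W.localPolynomialAt v = W'.localPolynomialAt v := by
  obtain ⟨ℓ, hℓ, hv⟩ := v.exists_prime_natCast_not_mem
  haveI : Fact ℓ.Prime := ⟨hℓ⟩
  have hc : Continuous fun x : absoluteGaloisGroup K × W.rationalTateModule ℓ ↦
      rationalTateRepresentation (absoluteGaloisGroup K) (geomPoints W) ℓ x.1 x.2 :=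
    continuous_rationalGaloisRepTate_holds W ℓ
  have hc' : Continuous fun x : absoluteGaloisGroup K × W'.rationalTateModule ℓ ↦
      rationalTateRepresentation (absoluteGaloisGroup K) (geomPoints W') ℓ x.1 x.2 :=
    continuous_rationalGaloisRepTate_holds W' ℓ
  haveI hfin : Module.Finite ℚ_[ℓ] (W.rationalTateModule ℓ) :=
    module_finite_rationalTateModule_holds W ℓ
  haveI hfin' : Module.Finite ℚ_[ℓ] (W'.rationalTateModule ℓ) :=
    module_finite_rationalTateModule_holds W' ℓ
  have e₁ := hW ℓ hc hfin v hv
  have e₂ := hW' ℓ hc' hfin' v hv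
  apply Polynomial.map_injective (Int.castRingHom ℚ_[ℓ]) (Int.castRingHom ℚ_[ℓ]).injective_int
  rw [← e₁, ← e₂]
  exact φ.hasseWeilEulerFactor_eq ℓ hc hc' v

end NumberField

end Isogeny

section NumberField

variable {K : Type u} [Field K] [NumberField K] {W W' : WeierstrassCurve K}
  [W.IsElliptic] [W'.IsElliptic]

/-- **`K`-isogenous elliptic curves over a number field have the same `L`-function**
(`WeierstrassCurve.LFunction`, Mathlib's formal Euler product), granted the Euler-factor
description of the local polynomials of both curves (`hasseWeilEulerFactor_geomPoints`; Serre–Tate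
(1968), Thm. 3; Silverman, *AEC*, C.§16): the local polynomials agree place by place
(`Isogeny.localPolynomialAt_eq`), hence so do the Euler products
(`LFunction_eq_of_forall_localPolynomial_eq`).  Knapp, *Elliptic Curves*, Thm. 11.67 (stated
there over `ℚ`); Faltings (1983), §5, Korollar 2, (i) ⇒ (iv).
[cite: Knapp1993, Thm. 11.67 (PDF p. 281)] [cite: Faltings1983Endlichkeit, §5 Korollar 2] -/
theorem IsIsogenous.LFunction_eq_of_hasseWeilEulerFactor_geomPoints (hiso : IsIsogenous W W')
    (hW : ∀ (ℓ : ℕ) [Fact ℓ.Prime], W.hasseWeilEulerFactor_geomPoints ℓ)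
    (hW' : ∀ (ℓ : ℕ) [Fact ℓ.Prime], W'.hasseWeilEulerFactor_geomPoints ℓ) :
    W.LFunction = W'.LFunction :=
  hiso.elim fun φ => LFunction_eq_of_forall_localPolynomial_eq fun v =>
    φ.localPolynomialAt_eq hW hW' v

/-- Hence also the same `L`-series `L(E/K, s)` (`WeierstrassCurve.LSeries`). [folklore] -/
theorem IsIsogenous.LSeries_eq_of_hasseWeilEulerFactor_geomPoints (hiso : IsIsogenous W W')
    (hW : ∀ (ℓ : ℕ) [Fact ℓ.Prime], W.hasseWeilEulerFactor_geomPoints ℓ)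
    (hW' : ∀ (ℓ : ℕ) [Fact ℓ.Prime], W'.hasseWeilEulerFactor_geomPoints ℓ) :
    W.LSeries = W'.LSeries := by
  funext s
  simp only [WeierstrassCurve.LSeries, hiso.LFunction_eq_of_hasseWeilEulerFactor_geomPoints hW hW']

end NumberField

end WeierstrassCurve

/-! ## The named fact `LFunction_eq_of_isIsogenous` (Knapp, Thm. 11.67) from the Euler factors -/

namespace Literature.NumberTheory.EllipticCurves

open WeierstrassCurve

/-- **Reduction of Knapp's Theorem 11.67 to the Euler factors of the Tate module.**  The named
fact `LFunction_eq_of_isIsogenous` (`ℚ`-isogenous elliptic curves over `ℚ` have the same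
`L`-function; Knapp, *Elliptic Curves*, Thm. 11.67, PDF p. 281) follows from the named fact
`WeierstrassCurve.hasseWeilEulerFactor_geomPoints W ℓ` of `HasseWeilAbelian` for all elliptic
curves `W` over `ℚ` and all primes `ℓ` (the local polynomial at `p ≠ ℓ` is
`det(1 - σ_p T ∣ (V_ℓ E)_{I_p})`; Serre–Tate (1968), Thm. 3; Silverman, *AEC*, C.§16), by the
proved isomorphism `V_ℓ E ≅ V_ℓ E'` along an isogeny and the factor-by-factor comparison of the
Euler products — Knapp's "The two `L` functions will be equal factor by factor", carried out at
every prime rather than only at `p ∤ ΔΔ'`.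
[cite: Knapp1993, Thm. 11.67 (PDF pp. 281–282)] [cite: SerreTate1968, Thm. 3] -/
theorem LFunction_eq_of_isIsogenous_of_hasseWeilEulerFactor_geomPoints
    (hHW : ∀ (W : WeierstrassCurve ℚ) [W.IsElliptic] (ℓ : ℕ) [Fact ℓ.Prime],
      W.hasseWeilEulerFactor_geomPoints ℓ) :
    LFunction_eq_of_isIsogenous :=
  fun W W' _ _ hiso =>
    hiso.LFunction_eq_of_hasseWeilEulerFactor_geomPoints (fun ℓ _ => hHW W ℓ) fun ℓ _ => hHW W' ℓ

end Literature.NumberTheory.EllipticCurves
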